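import Summits.BirchSwinnertonDyer.BirchSwinnertonDyer.Theorems.ManinLocalTwoThreeShimuraThreeTorsionCoprimeTotient
import Summits.BirchSwinnertonDyer.BirchSwinnertonDyer.Theorems.ManinLocalTwoThreeKummerCoverNotGammaOneReal
import Summits.BirchSwinnertonDyer.BirchSwinnertonDyer.Theorems.ManinLocalTwoThreeMinimalThreeTorsionAlgInt
import HarnessLib

/-!
# The Shimura `3`-kernel, PINNED (unconditional): `KummerShimura D u` at `9 ∣ N` forces `u ∉ Λ_E`, `Λ₁(f) = ℤ·(3u/c) + 3Λ₀(f)` EXACTLY, `ū + u ∈ Λ_E`, `re ℘'(u) = 0`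
(route `ManinLocalTwoThree`, crux C3 `ManinPrimeToThreeAtNine` stmt-BirchSwinnertonDyer-22968; cell bsd-f2-manin, C3 LEAD p1 gen 17;
`--supports stmt-BirchSwinnertonDyer-22968`; node E-an-221 `ShimuraThreeTorsion.ShimuraThreeKernelForcesRationalThreeTorsionAtNine` — sequel to
`…ShimuraThreeTorsionCoprimeTotient` (p740101: the habitat `3 ∣ φ(N/3)`))

WHAT.  In the hypothesis of E-an-221 (lattice-optimal `X₀(N)`-datum `D`, `9 ∣ N`, a third-period `u` — `3u ∈ Λ_E = cΛ₀(f)` — all of whose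
`Γ₁(N)`-Kummer periods are trivial, `KummerShimura D u`) the tree already pins everything about the Shimura kernel except its arithmetic:
* §1 `not_mem_lattice_of_kummerShimura` — **`u ∉ Λ_E` is AUTOMATIC** (else `Λ₁(f) = 3Λ₀(f)`, the index-`9` configuration excluded by the lead's
  g14 `not_periodLatticeGamma1_eq_three_mul_periodLattice`): E-an-221's binder `u ∉ D.L.lattice` is idle;
* §2 `three_mul_div_mem_periodLatticeGamma1_of_kummerShimura` (`3u/c ∈ Λ₁(f)`), **`mem_periodLatticeGamma1_iff_of_kummerShimura`** —
  **`Λ₁(f) = ℤ·(3u/c) + 3Λ₀(f)` EXACTLY** (DICTΣ gives `⊆`; `3Λ₀ ⊆ Λ₁` (traceless `3`) and the index-`9` exclusion give a kernel generator,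
  hence `⊇`): the Shimura quotient has order exactly `3` and `E₀ ∩ Σ(N)[3^∞] = ⟨P_u⟩`, `P_u = (c²℘(u), c³℘'(u)/2)`;
* §3 `conj_add_self_mem_lattice_of_kummerShimura` — **`ū + u ∈ Λ_E`**, i.e. `P̄_u = −P_u` (the `(−1)`-eigenline of conjugation on `Λ₀/3Λ₀`,
  lead g14 `conj_add_self_mem_three_mul_of_mem_periodLatticeGamma1`); `conj_weierstrassP_of_kummerShimura` (`℘(u)` real),
  `conj_derivWeierstrassP_of_kummerShimura` (`℘'(u)` purely imaginary), and for a `K`-point `T = (X₀, Y₀)` of the short model lifting to `u`: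
  `conj_eq_neg_of_kummerShimura` (`Ȳ₀ = −Y₀`) and **`sq_lt_zero_of_kummerShimura`** (`Y₀² = r < 0`, `r ∈ ℚ`): a Shimura `K`-point is
  IMAGINARY-quadratic (`K = ℚ(√r)`, `r < 0`) — the real-quadratic and rational types are excluded unconditionally (this is the lead's g16 GENΣ
  real case read through §2);
* §4 the STUB CUT **`shimuraThreeKernelForcesRationalThreeTorsionAtNine_of_pinned`**: E-an-221 follows from (indeed is equivalent to) E-an-221†
  «lattice-optimal, `9 ∣ N`, `3 ∣ φ(N/3)`, `3u ∈ Λ_E`, `Λ₁(f) = ℤ·(3u/c) + 3Λ₀(f)`, `ū + u ∈ Λ_E` ⟹ the short model `E_{W,c}` has a rational point of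
  order `3`» — i.e. E-an-221 IS the `3`-part of E-an-221♯ «`[Λ₀(f) : Λ₁(f)] ∣ #E₀(ℚ)_tors`» at `9 ∣ N`: **index `3` ⟹ rational `3`-torsion**.

HONEST FRAMING.  Unconditional lattice / real-structure theorems; E-an-221 itself (the arithmetic step «index 3 ⟹ rational 3-torsion on the OPTIMAL
curve», Mazur's Σ/C duality at prime level) is NOT proved; RES₃♭, C3, Manin's conjecture and BSD are NOT proved.  No definitions, no named facts,
no sorry.
[cite: Stevens1989, §2, Thm. 2.3 (shape: the Shimura covering E₁ → E₀)] [cite: LingOesterle1991, Thm. 1 (shape)] [cite: Manin1972, §1.6 (real structure)]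
-/

set_option autoImplicit false
-- lint-debt: the directory name repeats the summit name (sibling precedent `ManinLocalTwoThreeShimuraThreeTorsionCoprimeTotient.lean`)
set_option linter.dupNamespace false

noncomputable section

open scoped Classical ComplexConjugate MatrixGroups ModularForm PeriodPair
open CongruenceSubgroup Complex
open WeierstrassCurve Literature.NumberTheory.EllipticCurves Literature.NumberTheory.EllipticCurves.ModularForms
open Summit.BirchSwinnertonDyer.Rank1Residual.ManinAdditive.CuspidalKummer
open Summit.BirchSwinnertonDyer.Rank1Residual.ManinAdditive.CuspidalKummerThree
open Summit.BirchSwinnertonDyer.Rank1Residual.ManinAdditive.UDCKummerLine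
open Summit.BirchSwinnertonDyer.Rank1Residual.ManinAdditive.UDCKummerLineK
open Summit.BirchSwinnertonDyer.Rank1Residual.ManinAdditive.ShimuraThreeTorsion

namespace Summit.BirchSwinnertonDyer.BirchSwinnertonDyer.Theorems.ManinLocalTwoThree.SigmaHabitat

variable {W : WeierstrassCurve ℚ} [W.IsElliptic] [W.IsGloballyMinimal] {N : ℕ} [NeZero N]

/-! ## §1 `u ∉ Λ_E` is automatic -/

omit [W.IsElliptic] [W.IsGloballyMinimal] in
/-- **A Kummer–Shimura third-period is never a period**: `KummerShimura D u`, `3u ∈ Λ_E`, `9 ∣ N` ⟹ `u ∉ Λ_E` (else `Λ₁(f) ⊆ 3Λ₀(f)`, and with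
`3Λ₀ ⊆ Λ₁` the excluded index-`9` configuration `Λ₁ = 3Λ₀`). [cite: Stevens1989, §2 (shape)] -/
theorem not_mem_lattice_of_kummerShimura (D : ModularParametrizationData W N)
    (hopt : ∀ z ∈ D.L.lattice, ∃ w ∈ periodLattice D.f, z = D.c * w) (h9 : 3 ^ 2 ∣ N)
    {u : ℂ} (hS : KummerShimura D u) : u ∉ D.L.lattice := by
  intro hu
  have hc := cast_c_ne_zero_of_latticeOptimal D hopt
  obtain ⟨w₀, hw₀, huw₀⟩ := hopt u hu
  have h3uc : 3 * u / (D.c : ℂ) = 3 * w₀ := by rw [huw₀]; field_simp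
  refine not_periodLatticeGamma1_eq_three_mul_periodLattice D hopt fun z ↦ ⟨fun hz ↦ ?_, ?_⟩
  · obtain ⟨k, v, hv, rfl⟩ := kummerShimura_line D hopt hS z hz
    refine ⟨k * w₀ + v, add_mem ?_ hv, by rw [h3uc]; ring⟩
    simpa [zsmul_eq_mul] using (periodLattice D.f).zsmul_mem hw₀ k
  · rintro ⟨w, hw, rfl⟩
    exact three_mul_mem_periodLatticeGamma1_of_nine_dvd D h9 hw

/-! ## §2 `Λ₁(f) = ℤ·(3u/c) + 3Λ₀(f)` exactly -/

omit [W.IsElliptic] [W.IsGloballyMinimal] in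
/-- `Λ₁(f) ≠ Λ₀(f)` under `KummerShimura` (restated from the habitat file for convenience). [folklore] -/
theorem periodLatticeGamma1_ne_of_kummerShimura (D : ModularParametrizationData W N)
    (hopt : ∀ z ∈ D.L.lattice, ∃ w ∈ periodLattice D.f, z = D.c * w)
    {u : ℂ} (hu₂ : 3 * u ∈ D.L.lattice) (hS : KummerShimura D u) :
    periodLatticeGamma1 D.f ≠ periodLattice D.f :=
  periodLatticeGamma1_ne_of_subset_line D hopt hu₂ (kummerShimura_line D hopt hS)

omit [W.IsElliptic] [W.IsGloballyMinimal] in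
/-- **`3u/c ∈ Λ₁(f)`**: the generator of the DICTΣ line IS a `Γ₁(N)`-period.  A kernel generator `z ∈ Λ₁ ∖ 3Λ₀` exists (index `9` excluded,
`3Λ₀ ⊆ Λ₁`); `z = k·(3u/c) + 3v` with `3 ∤ k`, and `k ≡ ±1 (mod 3)` gives `±(3u/c) ∈ Λ₁ + 3Λ₀ = Λ₁`. [cite: Stevens1989, §2 (shape)] -/
theorem three_mul_div_mem_periodLatticeGamma1_of_kummerShimura (D : ModularParametrizationData W N)
    (hopt : ∀ z ∈ D.L.lattice, ∃ w ∈ periodLattice D.f, z = D.c * w) (h9 : 3 ^ 2 ∣ N)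
    {u : ℂ} (hu₂ : 3 * u ∈ D.L.lattice) (hS : KummerShimura D u) :
    3 * u / (D.c : ℂ) ∈ periodLatticeGamma1 D.f := by
  have h3Λ : ∀ v ∈ periodLattice D.f, (3 : ℂ) * v ∈ periodLatticeGamma1 D.f :=
    fun v hv ↦ three_mul_mem_periodLatticeGamma1_of_nine_dvd D h9 hv
  have hg : 3 * u / (D.c : ℂ) ∈ periodLattice D.f := three_mul_div_mem_periodLattice D hopt hu₂
  -- a kernel generator
  have key : ∃ z ∈ periodLatticeGamma1 D.f, ∀ w ∈ periodLattice D.f, z ≠ 3 * w := by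
    by_contra hne
    push Not at hne
    exact not_periodLatticeGamma1_eq_three_mul_periodLattice D hopt fun z ↦
      ⟨fun hz ↦ hne z hz, fun ⟨w, hw, hzw⟩ ↦ hzw ▸ h3Λ w hw⟩
  obtain ⟨z, hz, hz3⟩ := key
  obtain ⟨k, v, hv, hzk⟩ := kummerShimura_line D hopt hS z hz
  -- `3 ∤ k`
  have hk3 : ¬ (3 : ℤ) ∣ k := by
    rintro ⟨j, rfl⟩
    refine hz3 (j * (3 * u / D.c) + v) (add_mem ?_ hv) ?_
    · simpa [zsmul_eq_mul] using (periodLattice D.f).zsmul_mem hg j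
    · rw [hzk]; push_cast; ring
  -- `r·(3u/c) ∈ Λ₁` for `r = k mod 3 ∈ {1, 2}`
  set g : ℂ := 3 * u / (D.c : ℂ) with hg_def
  have hq : (k : ℂ) = 3 * ((k / 3 : ℤ) : ℂ) + ((k % 3 : ℤ) : ℂ) := by
    have h := congrArg (fun t : ℤ ↦ (t : ℂ)) (show k = 3 * (k / 3) + k % 3 by omega)
    push_cast at h
    exact h
  have hrg : ((k % 3 : ℤ) : ℂ) * g ∈ periodLatticeGamma1 D.f := by
    have hmem : ((k / 3 : ℤ) : ℂ) * g + v ∈ periodLattice D.f :=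
      add_mem (by simpa [zsmul_eq_mul] using (periodLattice D.f).zsmul_mem hg (k / 3)) hv
    have h3 := h3Λ _ hmem
    have he : ((k % 3 : ℤ) : ℂ) * g = z - 3 * (((k / 3 : ℤ) : ℂ) * g + v) := by
      rw [hzk, hq]; ring
    rw [he]
    exact sub_mem hz h3
  have h3g : (3 : ℂ) * g ∈ periodLatticeGamma1 D.f := h3Λ g hg
  rcases (show k % 3 = 1 ∨ k % 3 = 2 by omega) with h1 | h2
  · simpa [h1] using hrg
  · rw [h2] at hrg
    have he : g = 3 * g - ((2 : ℤ) : ℂ) * g := by push_cast; ring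
    rw [he]
    exact sub_mem h3g hrg

omit [W.IsElliptic] [W.IsGloballyMinimal] in
/-- **The Shimura `3`-kernel pinned: `Λ₁(f) = ℤ·(3u/c) + 3Λ₀(f)` EXACTLY** under `KummerShimura D u` (`9 ∣ N`, lattice-optimal, `3u ∈ Λ_E`).
So `[Λ₀(f) : Λ₁(f)] = 3` and the kernel of the Shimura cover `E₀ → E₁` is `⟨P_u⟩`. [cite: Stevens1989, §2 (shape)] [cite: LingOesterle1991, Thm. 1 (shape)] -/
theorem mem_periodLatticeGamma1_iff_of_kummerShimura (D : ModularParametrizationData W N)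
    (hopt : ∀ z ∈ D.L.lattice, ∃ w ∈ periodLattice D.f, z = D.c * w) (h9 : 3 ^ 2 ∣ N)
    {u : ℂ} (hu₂ : 3 * u ∈ D.L.lattice) (hS : KummerShimura D u) (z : ℂ) :
    z ∈ periodLatticeGamma1 D.f ↔ ∃ k : ℤ, ∃ v ∈ periodLattice D.f, z = k * (3 * u / D.c) + 3 * v := by
  refine ⟨kummerShimura_line D hopt hS z, ?_⟩
  rintro ⟨k, v, hv, rfl⟩
  have hg := three_mul_div_mem_periodLatticeGamma1_of_kummerShimura D hopt h9 hu₂ hS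
  refine add_mem ?_ (three_mul_mem_periodLatticeGamma1_of_nine_dvd D h9 hv)
  simpa [zsmul_eq_mul] using (periodLatticeGamma1 D.f).zsmul_mem hg k

omit [W.IsElliptic] [W.IsGloballyMinimal] in
/-- `3u/c` is a kernel generator: `3u/c ∈ Λ₁(f) ∖ 3Λ₀(f)`. [folklore] -/
theorem three_mul_div_ne_three_mul_of_kummerShimura (D : ModularParametrizationData W N)
    (hopt : ∀ z ∈ D.L.lattice, ∃ w ∈ periodLattice D.f, z = D.c * w) (h9 : 3 ^ 2 ∣ N)
    {u : ℂ} (hS : KummerShimura D u) : ∀ v ∈ periodLattice D.f, 3 * u / (D.c : ℂ) ≠ 3 * v := by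
  intro v hv he
  have hc := cast_c_ne_zero_of_latticeOptimal D hopt
  refine not_mem_lattice_of_kummerShimura D hopt h9 hS ?_
  have he' := (div_eq_iff hc).mp he
  have hu : u = D.c * v := by linear_combination he' / 3
  rw [hu]
  exact D.smul_periodLattice_le v hv

/-! ## §3 The kernel point is imaginary: `ū + u ∈ Λ_E`, `℘(u)` real, `℘'(u)` purely imaginary, `Y₀² < 0` -/

omit [W.IsElliptic] [W.IsGloballyMinimal] in
/-- **`ū + u ∈ Λ_E`** (`P̄_u = −P_u`): the DICTΣ generator `3u/c ∈ Λ₁(f)` lies on the `(−1)`-eigenline of conjugation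
(`conj_add_self_mem_three_mul_of_mem_periodLatticeGamma1`). [cite: Manin1972, §1.6 (real structure)] -/
theorem conj_add_self_mem_lattice_of_kummerShimura (D : ModularParametrizationData W N)
    (hopt : ∀ z ∈ D.L.lattice, ∃ w ∈ periodLattice D.f, z = D.c * w) (h9 : 3 ^ 2 ∣ N)
    {u : ℂ} (hu₂ : 3 * u ∈ D.L.lattice) (hS : KummerShimura D u) : conj u + u ∈ D.L.lattice := by
  have hc := cast_c_ne_zero_of_latticeOptimal D hopt
  obtain ⟨v, hv, hvw⟩ := conj_add_self_mem_three_mul_of_mem_periodLatticeGamma1 D hopt h9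
    (periodLatticeGamma1_ne_of_kummerShimura D hopt hu₂ hS)
    (three_mul_div_mem_periodLatticeGamma1_of_kummerShimura D hopt h9 hu₂ hS)
  have he : conj u + u = D.c * v := by
    have h := hvw
    rw [map_div₀, map_mul, map_intCast, map_ofNat, ← add_div, div_eq_iff hc] at h
    linear_combination h / 3
  rw [he]
  exact D.smul_periodLattice_le v hv

omit [W.IsElliptic] [W.IsGloballyMinimal] in
/-- **`℘(u)` is real** for a Kummer–Shimura third-period. [cite: Lawden1989, §6.15] -/
theorem conj_weierstrassP_of_kummerShimura (D : ModularParametrizationData W N)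
    (hopt : ∀ z ∈ D.L.lattice, ∃ w ∈ periodLattice D.f, z = D.c * w) (h9 : 3 ^ 2 ∣ N)
    {u : ℂ} (hu₂ : 3 * u ∈ D.L.lattice) (hS : KummerShimura D u) :
    conj (D.L.weierstrassP u) = D.L.weierstrassP u := by
  have hc := cast_c_ne_zero_of_latticeOptimal D hopt
  have h := conj_weierstrassP_kernel D hopt h9 (periodLatticeGamma1_ne_of_kummerShimura D hopt hu₂ hS)
    (three_mul_div_mem_periodLatticeGamma1_of_kummerShimura D hopt h9 hu₂ hS)
  have he : (D.c : ℂ) * (3 * u / (D.c : ℂ)) / 3 = u := by field_simp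
  rwa [he] at h

omit [W.IsElliptic] [W.IsGloballyMinimal] in
/-- **`℘'(u)` is purely imaginary** for a Kummer–Shimura third-period. [cite: Lawden1989, §6.15] -/
theorem conj_derivWeierstrassP_of_kummerShimura (D : ModularParametrizationData W N)
    (hopt : ∀ z ∈ D.L.lattice, ∃ w ∈ periodLattice D.f, z = D.c * w) (h9 : 3 ^ 2 ∣ N)
    {u : ℂ} (hu₂ : 3 * u ∈ D.L.lattice) (hS : KummerShimura D u) :
    conj (D.L.derivWeierstrassP u) = - D.L.derivWeierstrassP u := by
  have hc := cast_c_ne_zero_of_latticeOptimal D hopt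
  have h := conj_derivWeierstrassP_kernel D hopt h9 (periodLatticeGamma1_ne_of_kummerShimura D hopt hu₂ hS)
    (three_mul_div_mem_periodLatticeGamma1_of_kummerShimura D hopt h9 hu₂ hS)
  have he : (D.c : ℂ) * (3 * u / (D.c : ℂ)) / 3 = u := by field_simp
  rwa [he] at h

omit [W.IsElliptic] [W.IsGloballyMinimal] in
/-- **A Shimura `K`-point has purely imaginary ordinate**: if `c³℘'(u)/2 = Y₀` then `Ȳ₀ = −Y₀`. [folklore] -/
theorem conj_eq_neg_of_kummerShimura (D : ModularParametrizationData W N)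
    (hopt : ∀ z ∈ D.L.lattice, ∃ w ∈ periodLattice D.f, z = D.c * w) (h9 : 3 ^ 2 ∣ N)
    {u : ℂ} (hu₂ : 3 * u ∈ D.L.lattice) (hS : KummerShimura D u)
    {Y₀ : ℂ} (hY : (D.c : ℂ) ^ 3 * D.L.derivWeierstrassP u / 2 = Y₀) : conj Y₀ = -Y₀ := by
  rw [← hY, map_div₀, map_mul, map_pow, map_intCast, map_ofNat, conj_derivWeierstrassP_of_kummerShimura D hopt h9 hu₂ hS]
  ring

omit [W.IsElliptic] [W.IsGloballyMinimal] in
/-- **A Shimura `K`-point is imaginary-quadratic: `Y₀² = r` with `r ∈ ℚ`, `r < 0`** (`Y₀ ≠ 0` for a point of order `3`; `Ȳ₀ = −Y₀`).  So the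
rational (`Y₀ ∈ ℚ`) and real-quadratic types are never Kummer–Shimura — unconditionally. [folklore] -/
theorem sq_lt_zero_of_kummerShimura (D : ModularParametrizationData W N)
    (hopt : ∀ z ∈ D.L.lattice, ∃ w ∈ periodLattice D.f, z = D.c * w) (h9 : 3 ^ 2 ∣ N)
    {X₀ : ℚ} {Y₀ : ℂ} (hT : IsShortThreeTorsionC W D.c X₀ Y₀)
    {u : ℂ} (hu₂ : 3 * u ∈ D.L.lattice) (hS : KummerShimura D u)
    (hY : (D.c : ℂ) ^ 3 * D.L.derivWeierstrassP u / 2 = Y₀) :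
    ∃ r : ℚ, (r : ℂ) = Y₀ ^ 2 ∧ r < 0 := by
  obtain ⟨r, hr⟩ := MinimalThreeTorsionC.exists_ratCast_eq_sq hT
  have hY0 : Y₀ ≠ 0 := MinimalThreeTorsionC.y_ne_zero hT
  have hconj := conj_eq_neg_of_kummerShimura D hopt h9 hu₂ hS hY
  -- `re Y₀ = 0`
  have hre : Y₀.re = 0 := by
    have h := congrArg Complex.re hconj
    simp only [Complex.conj_re, Complex.neg_re] at h
    linarith
  have him : Y₀.im ≠ 0 := by
    intro him
    exact hY0 (Complex.ext (by simpa using hre) (by simpa using him))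
  refine ⟨r, hr, ?_⟩
  have hr' : (r : ℝ) = (Y₀ ^ 2).re := by
    have h := congrArg Complex.re hr
    simpa using h
  have hsq : (Y₀ ^ 2).re = -(Y₀.im ^ 2) := by
    rw [sq, Complex.mul_re, hre]; ring
  have hlt : (r : ℝ) < 0 := by
    rw [hr', hsq]
    have := pow_pos (abs_pos.mpr him) 2
    nlinarith [sq_abs Y₀.im]
  exact_mod_cast hlt

/-! ## §4 The stub cut: E-an-221 ⟸ E-an-221† (the pinned form) -/

/-- **E-an-221 ⟸ E-an-221†.**  To prove E-an-221 one may assume, besides lattice-optimality and `9 ∣ N`: `3 ∣ φ(N/3)`, `3u ∈ Λ_E`,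
`Λ₁(f) = ℤ·(3u/c) + 3Λ₀(f)` exactly, and `ū + u ∈ Λ_E` — and must produce a rational point of order `3` on `E_{W,c}`.  (E-an-221† is thus
literally «index `[Λ₀(f) : Λ₁(f)] = 3` ⟹ `3 ∣ #E₀(ℚ)_tors`», the `3`-part of E-an-221♯.) [cite: Stevens1989, §2 (shape)] -/
theorem shimuraThreeKernelForcesRationalThreeTorsionAtNine_of_pinned
    (h : ∀ (W : WeierstrassCurve ℚ) [W.IsElliptic] [W.IsGloballyMinimal] {N : ℕ} [NeZero N]
      (D : ModularParametrizationData W N),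
      (∀ z ∈ D.L.lattice, ∃ w ∈ periodLattice D.f, z = D.c * w) → 3 ^ 2 ∣ N → 3 ∣ Nat.totient (N / 3) →
      ∀ u : ℂ, 3 * u ∈ D.L.lattice →
      (∀ z : ℂ, z ∈ periodLatticeGamma1 D.f ↔ ∃ k : ℤ, ∃ v ∈ periodLattice D.f, z = k * (3 * u / D.c) + 3 * v) →
      conj u + u ∈ D.L.lattice →
      ∃ X Y : ℚ, IsShortThreeTorsion W D.c X Y) :
    ShimuraThreeKernelForcesRationalThreeTorsionAtNine :=
  fun W _ _ _ _ D hopt h9 u _ hu₂ hS ↦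
    h W D hopt h9 (three_dvd_totient_div_three_of_kummerShimura D hopt h9 hu₂ hS) u hu₂
      (mem_periodLatticeGamma1_iff_of_kummerShimura D hopt h9 hu₂ hS) (conj_add_self_mem_lattice_of_kummerShimura D hopt h9 hu₂ hS)

end Summit.BirchSwinnertonDyer.BirchSwinnertonDyer.Theorems.ManinLocalTwoThree.SigmaHabitat

end
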